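import Mathlib
import HarnessLib
import HarnessLib.Audit
import Summits.NavierStokesRegularity.Statement
import Literature.Analysis.FluidPDE.ClassicalSolution
import Literature.Analysis.FluidPDE.LerayHopf
import Literature.Analysis.FluidPDE.NSWave0
import Literature.Analysis.FluidPDE.NormalisedPressure
import Summits.NavierStokesRegularity.NavierStokesRegularity.Theorems.TypeICertificateLadderNoBlowupToClay
import HarnessLib.Audit.Status.Attr

/-!
Route: HiddenConvexityPressureFloor

DORMANT since 2026-09-01T10:01:03Z (reconciler: no traction for 5 d (last activity statement-checked at 2026-08-27T09:16:06Z); parked, not closed — `ledger route dormant route-NavierStokesRegularity-HiddenConvexityPressureFloor --off` t) — unstaffed, not closed; items shared with open routes are served there. `ledger route dormant <id> --off` reactivates.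

# Route HiddenConvexityPressureFloor — NavierStokesRegularity (Clay A), positive side; card
NavierStokesRegularity/NavierStokesRegularity/hidden-convexity-pressure-floor ("viscosity makes
least action convex, convexity makes the pressure semiconcave, a semiconcave pressure has a floor,
and a floor is regularity").

## Thesis X = P ∧ C ("it suffices to show")
Notation: p̃(t) := normalisedPressure (u t) = −Δ⁻¹∂ᵢ∂ⱼ(uᵢuⱼ) (Riesz-normalised pressure,
Literature.Analysis.FluidPDE.normalisedPressure); K(t) := the SEMICONCAVITY MODULUS of p̃(t) = least
k ≥ 0 such that x ↦ p̃(t,x) − (k/2)‖x‖² is concave (= sup_x λ_max⁺ ∇²p̃(x,t) for C² slices; this is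
exactly Brenier's one-sided K(p) of the least-action minimality theorem, Brenier2020HiddenConvexity
Thm 3.1.1 p.44; Mathlib readback: StrongConcaveOn univ (−k)).
 P (FinitelyManyTurnovers): for every ν>0, T>0 and every finite-energy (Leray–Hopf) classical
solution (u,p) of unforced NS on ℝ³×[0,T) from a rapidly decaying datum, ∫₀ᵀ √K(t) dt < ∞. Reading:
a Brenier/Arnaudon–Cruzeiro–Léonard–Zambrini least-action (entropic, "Brödinger") minimality window
starting at t has length ≥ π/√(sup K), so P says "[0,T) is covered by finitely many least-action
time units"; it is scale-invariant (K ~ time⁻², like BKM's ∫‖ω‖∞).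
 C (OneSidedHessianCriterion): under the same hypotheses, ∫₀ᵀ √K(t) dt < ∞ ⇒ HasSmoothExtensionPast
ν 0 u T — a CRITICAL, ONE-SIDED, top-eigenvalue continuation criterion. Its bounded-K case is the
card's chain: K-semiconcave p̃ ⇒ pressure FLOOR p̃ ≥ −C(K,‖u‖₂) (Jensen against a radial bump + the
proved tree bound integral_normalisedPressure_mul_rescaled_le_holds) ⇒ regular by Seregin–Šverák
2002 (normalised pressure bounded below ⇒ no singularity).
Lean (both elaborate, Sketch.lean rc 0):
 P: ∀ ν T, 0<ν → 0<T → ∀ u p, IsClassicalNSSolutionOn (Set.Ico 0 T) ν 0 u p → IsLerayHopfOn T ν 0 (u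
0) u → HasRapidSpatialDecay (u 0) → ∃ k : ℝ → ℝ, (∀ t ∈ Set.Ico 0 T, 0 ≤ k t ∧ ConcaveOn ℝ Set.univ
(fun x ↦ normalisedPressure (u t) x − k t / 2 * ‖x‖²)) ∧ IntegrableOn (fun t ↦ √(k t)) (Set.Ico 0 T)
 C: same hypotheses → (∃ k, … as in P …) → HasSmoothExtensionPast ν 0 u T

## Assembly X → NavierStokesRegularity
P → C → NoBlowupToClay → NavierStokesRegularity, PURE LOGIC (term `assembly_holds` in Sketch.lean: P
hands the modulus k, C turns it into extension past every T, the shared local-theory assembly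
stmt-NavierStokesRegularity-0055 (re-asked here as support NoBlowupToClay) converts NoBlowup into
Clay (A)).

## Two-layer plan (D-0019)
Layer 1 (typed cruxes, ranked): P (rank 2) · C (rank 3) · SereginSverakFloorExtension (rank 4: the
unvendored named fact SS02 in the Clay class, made an explicit crux). Support (typed):
PressureFloorOfSemiconcave (floor lemma), UniformModulusNoBlowup (the card's original thesis "sup_t
K < ∞ ⇒ NoBlowup" = floor ∘ SS02, glue proved in Sketch), NoBlowupToClay (shared 0055). Layer 2
(later, by glued splits once a crux closes): C ⇐ {bounded-K case (= UniformModulusNoBlowup), a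
quantitative SS02 with time-dependent majorant g(t) ∈ L^{3/2}, a K-adapted floor at the viscous
scale}; P ⇐ {identification of p̃ with the Brödinger pressure multiplier on minimality windows
(definition requests BrodingerProblem / BrodingerPressure filed), semiconcavity of the multiplier
from entropic convex duality}.

Rationale: WHY THIS LINE. Two theorems from different fields meet through one sign: Seregin–Šverák 2002
(SereginSverak2002: a Leray–Hopf solution whose NORMALISED pressure is bounded below, or whose head
|u|²/2+p is bounded above, is regular — one sign of one scalar, no rate, no smallness) and Brenier's
hidden convexity of least action on SDiff (Brenier1989, Brenier1999, AmbrosioFigalli2007/2008,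
Brenier2020HiddenConvexity: the incompressibility multiplier of the relaxed convex problem IS the
pressure, unique and a-priori regular by duality; smooth flows are the unique minimisers exactly on
windows (t₁−t₀)²K(p) < π² where K(p) = sup λ_max ∇²ₓp is ONE-SIDED, Thm 3.1.1 p.44; Brenier p.29:
evidence that the multiplier is "locally in time semi-concave in x, and not more"). Viscosity makes
the relaxation strictly convex (entropic "Brödinger" problem ArnaudonEtAl2020 = arXiv:1704.02126,
unique generalized minimiser and scalar pressure BaradatMonsaingeon2019 = arXiv:1810.12036;
Brenier2020HiddenConvexity §5.3). The elementary bridge (support PressureFloorOfSemiconcave):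
semiconcavity modulus K ⇒ p̃(x₀) ≥ ∫p̃ψ(·−x₀) − cK (Jensen, ψ a radial bump) ≥ −M‖u‖₂² − cK by the
PROVED tree fact Literature.Analysis.FluidPDE.integral_normalisedPressure_mul_rescaled_le_holds ⇒
floor ⇒ SS02 ⇒ NoBlowup. Imported: convex duality / entropic optimal transport (the reading of K and
of windows), semiconcavity calculus (CannarsaSinestrari2004), ε-regularity + backward uniqueness
(inside SS02).
WHY NOT THE CARD'S WINDOW LAW (planner analysis, NOTES.md §Analysis). The card's crux
"sup_{[t,t+τ]}K ≤ Φ(K(t),E₀,ν,τ) iterable along minimality windows τ²K ≤ c₀" cannot be both true and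
iterable: (i) Φ depending on energy is refuted by DILUTION (a distant slow large-scale reservoir
raises E at frozen local dynamics) + NS scaling (E→E/λ, K→λ⁴K, τ²K invariant), which force Φ ≥
(1+θ)K₀ scale-free; (ii) a scale-free Φ = K₀h(τ²K₀) iterates to all times iff h(s) ≤ 1 for some s>0,
a lagged one-sided maximum principle refuted by any smooth flow with K increasing at one instant;
(iii) interior-gain laws K(mid) ≤ C₁/τ², 4C₁ < c₀, are refuted by steady/slowly varying intense
vortices (solid rotation is Brenier's sharp case τ²K = π²). Hence the a-priori half is filed in its
GLOBAL, scale-critical form P (∫√K dt = number of least-action time units) and the closing half in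
the matching critical form C; the card's uniform bound X (sup K < ∞) is the bounded sub-case (X ⇒ P
trivially; X ⇒ NoBlowup = support UniformModulusNoBlowup).
RANKED CRUXES. #2 P FinitelyManyTurnovers — hardest: a critical a-priori bound from supercritical
data; false under any self-similar or discretely self-similar blow-up (scaling covariance K ↦ λ⁴K
forces K(t) ≳ (T−t)⁻², so ∫√K = ∞) and, heuristically, under any Type-I collapse with a
rotation-dominated core (λ_max∇²p̃ ≥ (|ω|²/2−|S|²)/3). #3 C OneSidedHessianCriterion — new
continuation criterion; NOT implied by known theory: with Type-I depth |p̃_min| ~ (T−t)⁻¹ the energy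
floor only forces K ≳ |p̃_min|^{5/3}E^{-2/3}, i.e. √K ~ (T−t)^{-5/6}, integrable; semiconcavity (∇²p
≤ KI) is the side that does NOT enter strain-eigenvalue dynamics (DₜS = −S² − (ω⊗ω−|ω|²I)/4 − ∇²p +
νΔS needs a LOWER Hessian bound, cf. Chae2008 where p_rr ≥ 0 drives Euler blow-up), so C must come
from the non-local floor/ε-regularity side — honest. #4 SereginSverakFloorExtension — SS02 in the
Clay class (cite-only, acq-01580): vendor as a Literature fact first; then this item is bookkeeping
(LPS continuation + CKN far field).
CALIBRATION. Solid-body core of angular velocity Ω: p = Ω²r²/2, K = Ω² = |ω|²/4; Δp̃ = |ω|²/2 − |S|²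
≤ 3K caps vorticity only by strain (|ω|² ≤ 2|S|² + 6K), so K < ∞ is not "ω bounded" in disguise;
Burgers/Lamb–Oseen: K constant/decaying; Beltrami decay: K(t) = e^{−2νλ²t}K(0).
KILL CRITERIA. ¬C: a finite-energy classical solution on [0,T) with ∫₀ᵀ√K < ∞ and no extension
(needs a blow-up: settles ¬A as well unless X5b fails) — or, cheaper and decisive for the LINE, a
suitable weak / Leray–Hopf example (outside the Clay class) singular at T with integrable √K, which
kills the mechanism behind C; ¬P with a smooth GLOBAL solution is impossible (smooth on [0,T] ⇒ K
bounded), so P dies only with Clay; SS02 mis-stated for the Clay class (g-class or up-to-T form) ⇒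
restate #4, not close. Route closes `refuted:C` on a Leray–Hopf counterexample to the criterion,
`superseded` if a pressure-criterion route subsumes C.
NOT DECOMPOSED YET. How P would be proved (identification of p̃ with the Brödinger multiplier on
windows τ²K < π² — ACLZ §§4–5 + Brenier Thm 3.1.1 with the entropic term; torus first, ℝ³ by
localisation — and a duality-side semiconcavity estimate for the multiplier that is GLOBAL in the
window count, not per-window): definition requests BrodingerProblem / BrodingerPressure filed for
the route, no statement items until they land. How C would be proved beyond bounded K
(time-dependent majorant g(t) ∈ L^{3/2} in SS02's parabolic-Morrey class + a floor at the K-adapted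
scale r ~ (E/K)^{1/5}). The assembly's local theory (shared 0055, grounder ruling on fact hypotheses
stands).
PRIOR-PROGRAM NOTES: docs/m5/inspiration not read (plancard mode; nothing reused).

Novelty: NOVELTY (searched 2026-08-15 by this planner: `lit search --hybrid "Navier-Stokes equations with
lower bounds on the pressure Seregin Sverak"` (held books only: robinson2016 p.341 bibliography,
seregin2014 — SS02 itself cite-only, acq-01580), `lit search --hybrid "regularity criterion
Navier-Stokes pressure Hessian eigenvalue"` and `lit vsearch "regularity criterion … largest
eigenvalue of the pressure Hessian; semiconcave pressure"` (12 book hits, none on a one-sided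
second-order pressure criterion), `lit read paper:w3082564424` pp.29, 44, 93–95 (Brenier's book:
K(p) one-sided, Thm 3.1.1; semiconcavity of the relaxed pressure stated as plausible, no link to
regularity), `lit galaxy search "lower bounds on the pressure" --star all` (5 irrelevant rows;
pdf/crabby stars saturated), zbMATH row for doi:10.1007/s002050200199 (review withheld),
OpenAlex/S2/arXiv rate-limited (recorded); plus the card's own searches and the refuter novelty
audit of 2026-08-15 (grade new-combination). Nearest prior art: SereginSverak2002
(doi:10.1007/s002050200199: zeroth-order one-sided pressure/head criterion — the closing tool,
cited); BerselliGaldi2002 and ChaeLee2001 (two-sided pressure criteria p ∈ L^r_t L^s_x, 2/r+3/s = 2)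
and the ∇p criteria with 2/r+3/s = 3; Miller2019 and NeustupaPenel2001 (critical criteria through
ONE signed eigenvalue — of the strain, not of ∇²p); Chae2008 (arXiv:0803.1784) and Constantin2007
(LOWER bounds on the pressure Hessian as an Euler blow-up engine — the opposite  [refs: 10.1007/s002050200199, 10.1007/s002050200199:, 0803.1784, 1704.02126, 1810.12036, paper:w3082564424, doi:10.1007/s002050200199, SereginSverak2002, BerselliGaldi2002, ChaeLee2001, Miller2019, NeustupaPenel2001, Chae2008, Constantin2007, Brenier1999, AmbrosioFigalli2007, AmbrosioFigalli2008, ArnaudonEtAl2020, BaradatMonsaingeon2019]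

Barriers (technique_class: hidden-convexity pressure-semiconcavity one-sided-hessian): BARRIERS (catalogue Literature/Barriers/NavierStokesRegularity read: 18 technique-classed entries;
technique_class: hidden-convexity pressure-semiconcavity one-sided-hessian).
- Literature.Barriers.NavierStokesRegularity.EnergySupercriticality: NOT evaded by crux P — ∫√K dt
is scale-invariant (critical) information to be won from supercritical data, and the planner's
dilution/scaling analysis shows every energy-dependent propagation law for K is false; the bet is
that the one-sided K is controlled by CONVEX-DUALITY structure of least action (sign-ful,
inf-structure information: minimality windows, semiconcave multipliers), which is not a coercive
energy-class quantity. C and the floor lemma use the energy only subcritically (floor constant),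
which the barrier allows.
- Literature.Barriers.NavierStokesRegularity.TaoAveragedBlowup and
Literature.Barriers.NavierStokesRegularity.TruncatedDyadicBlowup: an averaged bilinear B̃ keeps the
energy identity but has neither a pressure that is a Riesz transform of u⊗u nor a
least-action/path-measure variational origin (NS = Brownian least action on SDiff via Girsanov
entropy, ArnaudonEtAl2020); SS02 and any proof of C run on ε-regularity + backward uniqueness with
the true pressure equation — fine structure outside Tao's class (arXiv:1402.0290 p.8). So the line
is not an "abstract energy + harmonic analysis" argument; whether that suffices is the bet.
- Literature.Barriers.NavierStokesRegularity.NavierStokesInequalitySingularSolution: Sch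

History (route lifecycle, newest last):
- 2026-08-16T14:43:06Z · LINT AUTOFIX route.multi-assembly: kept Assembly, dropped Assembly2 (gate:hygiene)
- 2026-08-22T08:38:59Z · DORMANT — reconciler: no traction for 5.2 d (last activity item-evidence-added at 2026-08-17T03:03:06Z); parked, not closed — `ledger route dormant route-NavierStokesRegu (operator:999:1706320)
- 2026-08-27T06:25:44Z · REACTIVATED — reconciler: reactivated — activity item-proof-filed at 2026-08-27T04:23:14Z after parking at 2026-08-22T08:38:59Z (operator:999:1692378)
- 2026-09-01T10:01:03Z · DORMANT — reconciler: no traction for 5 d (last activity statement-checked at 2026-08-27T09:16:06Z); parked, not closed — `ledger route dormant route-NavierStokesRegulari (operator:999:1350124)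

sub-problem: NavierStokesRegularity · status: dormant · opened planner-plancard-NavierStokesRegularity-Navie-6cf2b33a-0 2026-08-15T11:09:46Z · rev 6 · ledger route-NavierStokesRegularity-HiddenConvexityPressureFloor
GENERATED by the gate from the ledger (D-0016/17). Provers cite these decls: `theorem foo : Summit.NavierStokesRegularity.NavierStokesRegularity.Theses.HiddenConvexityPressureFloor.<Decl> := …` in Summits/NavierStokesRegularity/NavierStokesRegularity/Theorems/<Name>.lean.
-/

namespace Summit.NavierStokesRegularity.NavierStokesRegularity.Theses.HiddenConvexityPressureFloor

open scoped BigOperators Topology Manifold Classical MeasureTheory ProbabilityTheory Matrix InnerProductSpace ComplexConjugate ContinuousMap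
open Filter Set Function TopologicalSpace MeasureTheory

attribute [summit_statement] _root_.NavierStokesRegularity

open Literature.NS

/-- item stmt-NavierStokesRegularity-2961 · crux · rank 2 · open · by planner
why it might fail: Critical a-priori bound from supercritical (energy-class) data: false under any (discretely) self-similar blow-up — scaling K↦λ⁴K forces K(t) ≳ (T−t)⁻², so ∫√K dt = ∞ — i.e. P has blow-up-excluding strength; dilution×scaling refute every energy-dependent per-window law: engine must be global.
sources: Brenier2020HiddenConvexity, ArnaudonEtAl2020, BaradatMonsaingeon2019, BealeKatoMajda1984, Hou2022PotentiallySingularNS, Literature.Barriers.NavierStokesRegularity.EnergySupercriticality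
[crux] P — FINITELY MANY LEAST-ACTION TIME UNITS: for every ν>0, T>0 and every finite-energy
(Leray–Hopf) classical solution of unforced NS on ℝ³×[0,T) from a rapidly decaying datum there is a
modulus k(t) ≥ 0 with x ↦ p̃(t,x) − k(t)/2·‖x‖² concave (p̃ = normalisedPressure (u t) =
−Δ⁻¹∂ᵢ∂ⱼ(uᵢuⱼ); Mathlib readback: StrongConcaveOn univ (−k t)) and ∫₀ᵀ √k dt < ∞. K = inf k = sup_x
λ_max⁺∇²p̃ is Brenier's one-sided constant: a least-action minimality window from t has length ≥
π/√(sup K) (Brenier2020HiddenConvexity Thm 3.1.1 p.44; entropic NS version ArnaudonEtAl2020), so P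
reads '[0,T) is covered by finitely many Brenier/ACLZ minimality windows'. Scale-invariant (K ~
time⁻², cf. BKM ∫‖ω‖∞). The card's uniform bound sup K < ∞ implies P (Sketch:
finitelyManyTurnovers_of_uniform). Calibration: solid core K = Ω² = |ω|²/4 and in general λ_max∇²p̃
≥ (|ω|²/2 − |S|²)/3 at rotation-dominated points; a (discretely) self-similar blow-up has K ~
(T−t)⁻² by scaling, ∫√K = ∞. Intended engine (layer 2, not filed): identification of p̃ with the
Brödinger pressure multiplier on windows + a duality-side semiconcavity estimate GLOBAL in the
window count (window-local laws are excluded: rationale §WHY N -/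
@[route_item "route-NavierStokesRegularity-HiddenConvexityPressureFloor", crux]
def FinitelyManyTurnovers : Prop :=
  ∀ (ν T : ℝ), 0 < ν → 0 < T → ∀ (u : ℝ → EuclideanSpace ℝ (Fin 3) → EuclideanSpace ℝ (Fin 3)) (p : ℝ → EuclideanSpace ℝ (Fin 3) → ℝ), Literature.Analysis.FluidPDE.IsClassicalNSSolutionOn (Set.Ico 0 T) ν 0 u p → Literature.Analysis.FluidPDE.IsLerayHopfOn T ν 0 (u 0) u → Literature.Analysis.FluidPDE.HasRapidSpatialDecay (u 0) → ∃ k : ℝ → ℝ, (∀ t ∈ Set.Ico 0 T, 0 ≤ k t ∧ ConcaveOn ℝ Set.univ (fun x : EuclideanSpace ℝ (Fin 3) => Literature.Analysis.FluidPDE.normalisedPressure (u t) x - k t / 2 * ‖x‖ ^ 2)) ∧ MeasureTheory.IntegrableOn (fun t => Real.sqrt (k t)) (Set.Ico 0 T)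

/-- item stmt-NavierStokesRegularity-2962 · crux · rank 3 · open · by planner
why it might fail: New criterion, not implied by SS02 + energy floor (Type-I depth |p̃_min|~(T−t)⁻¹ forces only √K~(T−t)^(−5/6), integrable); ∇²p̃ ≤ K·I caps only |ω|²−2|S|², the side absent from strain dynamics (Chae2008), so a strain-dominated collapse with wide pressure wells could blow up with ∫√K dt < ∞.
sources: SereginSverak2002, BerselliGaldi2002, ChaeLee2001, Miller2019, NeustupaPenel2001, Chae2008
[crux] C — ONE-SIDED HESSIAN CONTINUATION CRITERION: same hypotheses; if some modulus k ≥ 0 makes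
every slice p̃(t) k(t)-semiconcave and ∫₀ᵀ √k dt < ∞ then the solution extends classically past T
(HasSmoothExtensionPast ν 0 u T). The endpoint (r,s) = (1/2,∞), one-sided, top-eigenvalue-only
member of the pressure-criterion family (p ∈ L^rL^s with 2/r+3/s = 2: BerselliGaldi2002,
ChaeLee2001; ∇p with 2/r+3/s = 3; zeroth-order one-sided: SereginSverak2002). Bounded-k case =
support UniformModulusNoBlowup (floor lemma + SS02). Beyond bounded k the known theory does not
suffice: the floor at the K-adapted scale r ~ (E/K)^{1/5} gives p̃_min ≥ −C E^{2/5}K^{3/5}, so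
Type-I depth |p̃_min| ~ (T−t)⁻¹ forces only √K ~ (T−t)^{-5/6} (integrable) — C is a genuinely new
statement; a proof needs SS02 with a time-dependent majorant g(t) (parabolic-Morrey class) plus a
better-than-energy floor, or a new mechanism. Analogue for calibration: Miller2019 (critical
criterion via one signed eigenvalue of the strain). -/
@[route_item "route-NavierStokesRegularity-HiddenConvexityPressureFloor", crux]
def OneSidedHessianCriterion : Prop :=
  ∀ (ν T : ℝ), 0 < ν → 0 < T → ∀ (u : ℝ → EuclideanSpace ℝ (Fin 3) → EuclideanSpace ℝ (Fin 3)) (p : ℝ → EuclideanSpace ℝ (Fin 3) → ℝ), Literature.Analysis.FluidPDE.IsClassicalNSSolutionOn (Set.Ico 0 T) ν 0 u p → Literature.Analysis.FluidPDE.IsLerayHopfOn T ν 0 (u 0) u → Literature.Analysis.FluidPDE.HasRapidSpatialDecay (u 0) → (∃ k : ℝ → ℝ, (∀ t ∈ Set.Ico 0 T, 0 ≤ k t ∧ ConcaveOn ℝ Set.univ (fun x : EuclideanSpace ℝ (Fin 3) => Literature.Analysis.FluidPDE.normalisedPressure (u t) x - k t / 2 * ‖x‖ ^ 2)) ∧ MeasureTheory.IntegrableOn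 (fun t => Real.sqrt (k t)) (Set.Ico 0 T)) → Literature.Analysis.FluidPDE.HasSmoothExtensionPast ν 0 u T

/-- item stmt-NavierStokesRegularity-2963 · support · rank 4 · closed · proved by Summit.NavierStokesRegularity.NavierStokesRegularity.Theorems.hiddenConvexityPressureFloor_sereginSverakFloorExtension_proof (prover) · by planner
why it might fail: May fail AS STATED by class bookkeeping: SS02 is printed for Leray–Hopf/suitable solutions with a Morrey-class majorant and gives regularity up to T; 'extends classically past T' also needs LPS continuation + CKN far-field control not in tree; source cite-only (acq-01580), locator unverified.
sources: SereginSverak2002, arXiv:2103.12237, arXiv:1811.03304, CKN1982, Serrin1962, Literature.Analysis.FluidPDE.ladyzhenskaya_prodi_serrin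
[crux] SEREGIN–ŠVERÁK 2002 IN THE CLAY CLASS (unvendored named fact made explicit; vendor FIRST as a
Literature fact, e.g. `seregin_sverak_pressure_lower_bound`, then this item is bookkeeping): same
hypotheses; if the normalised pressure is bounded below on [0,T)×ℝ³ (∃M ∀t<T ∀x, −M ≤ p̃(t,x)) then
the solution extends classically past T. SS02 (ARMA 163 (2002) 65–86, doi:10.1007/s002050200199;
cite-only, acq-01580): a Leray–Hopf solution of the Cauchy problem whose normalised pressure p =
RᵢRⱼ(uᵢuⱼ) satisfies p ≥ −g (or |u|²/2 + p ≤ g) with g in the paper's admissible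
(parabolic-Morrey-type) class — constants included — has no singular point up to T. To close this
item from the fact: regularity up to T ⇒ u ∈ L^∞ near T on compacts; CKN ε-regularity far out (tails
of the energy) ⇒ u bounded on ℝ³×(T−δ,T) ⇒ LPS continuation (ladyzhenskaya_prodi_serrin, r = ∞) ⇒
classical extension; cf. grounder notes on stmt-0055 for the same far-field step. Exact theorem
number / g-class to be pinned from the paper on vendoring. -/
@[route_item "route-NavierStokesRegularity-HiddenConvexityPressureFloor"]
def SereginSverakFloorExtension : Prop :=
  ∀ (ν T : ℝ), 0 < ν → 0 < T → ∀ (u : ℝ → EuclideanSpace ℝ (Fin 3) → EuclideanSpace ℝ (Fin 3)) (p : ℝ → EuclideanSpace ℝ (Fin 3) → ℝ), Literature.Analysis.FluidPDE.IsClassicalNSSolutionOn (Set.Ico 0 T) ν 0 u p → Literature.Analysis.FluidPDE.IsLerayHopfOn T ν 0 (u 0) u → Literature.Analysis.FluidPDE.HasRapidSpatialDecay (u 0) → (∃ M : ℝ, ∀ t ∈ Set.Ico 0 T, ∀ x : EuclideanSpace ℝ (Fin 3), -M ≤ Literature.Analysis.FluidPDE.normalisedPressure (u t) x) → Literature.Analysis.FluidPDE.HasSmoothExtensionPast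 ν 0 u T

-- `SereginSverakFloorExtension` holds: proved by `Summit.NavierStokesRegularity.NavierStokesRegularity.Theorems.hiddenConvexityPressureFloor_sereginSverakFloorExtension_proof` (its module imports this route file, so no `_holds` link can be stated here).

/-- item stmt-NavierStokesRegularity-2964 · support · rank 9 · closed · proved by Summit.NavierStokesRegularity.NavierStokesRegularity.Theorems.hiddenConvexityPressureFloor_pressureFloorOfSemiconcave_proof (prover) · by planner
sources: Literature.Analysis.FluidPDE.integral_normalisedPressure_mul_rescaled_le_holds, Tao2011, CannarsaSinestrari2004
[support] FLOOR LEMMA (the card's bridge, provable now): same hypotheses; if every slice p̃(t), t<T,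
is K-semiconcave (x ↦ p̃(t,x) − K/2‖x‖² concave) then p̃ is bounded below on [0,T)×ℝ³. Proof sketch:
q := p̃(t) − K/2‖·−x₀‖² is concave (differs from the hypothesis by an affine function), so by Jensen
(Mathlib ConcaveOn.le_map_integral / le_map_centerMass) against a fixed radial bump probability
density ψ(·−x₀): p̃(t,x₀) = q(x₀) ≥ ∫ q ψ(·−x₀) = ∫ p̃(t) ψ(·−x₀) − (K/2)∫‖y‖²ψ(y)dy; the PROVED
tree fact Literature.Analysis.FluidPDE.integral_normalisedPressure_mul_rescaled_le_holds (|∫ p̃[v]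
ψ(R⁻¹(x−x₀))dx| ≤ M∫|v|² for C¹ finite-energy v) and the Leray–Hopf energy inequality
(IsLerayHopfOn.energy_ineq_zero; ∫|u₀|² < ∞ from HasRapidSpatialDecay + continuity) give the uniform
floor −M‖u₀‖₂² − cK. -/
@[route_item "route-NavierStokesRegularity-HiddenConvexityPressureFloor"]
def PressureFloorOfSemiconcave : Prop :=
  ∀ (ν T : ℝ), 0 < ν → 0 < T → ∀ (u : ℝ → EuclideanSpace ℝ (Fin 3) → EuclideanSpace ℝ (Fin 3)) (p : ℝ → EuclideanSpace ℝ (Fin 3) → ℝ), Literature.Analysis.FluidPDE.IsClassicalNSSolutionOn (Set.Ico 0 T) ν 0 u p → Literature.Analysis.FluidPDE.IsLerayHopfOn T ν 0 (u 0) u → Literature.Analysis.FluidPDE.HasRapidSpatialDecay (u 0) → ∀ K : ℝ, (∀ t ∈ Set.Ico 0 T, ConcaveOn ℝ Set.univ (fun x : EuclideanSpace ℝ (Fin 3) => Literature.Analysis.FluidPDE.normalisedPressure (u t) x - K / 2 * ‖x‖ ^ 2)) → ∃ M : ℝ, ∀ t ∈ Set.Ico 0 T, ∀ x : EuclideanSpace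 ℝ (Fin 3), -M ≤ Literature.Analysis.FluidPDE.normalisedPressure (u t) x

-- `PressureFloorOfSemiconcave` holds: proved by `Summit.NavierStokesRegularity.NavierStokesRegularity.Theorems.hiddenConvexityPressureFloor_pressureFloorOfSemiconcave_proof` (its module imports this route file, so no `_holds` link can be stated here).

/-- item stmt-NavierStokesRegularity-2965 · support · rank 9 · closed · proved by Summit.NavierStokesRegularity.NavierStokesRegularity.Theorems.hiddenConvexityPressureFloor_uniformModulusNoBlowup_proof (prover) · by planner
sources: SereginSverak2002, Brenier2020HiddenConvexity
[support] THE CARD'S ORIGINAL THESIS AS GLUE: (X) 'every finite-energy classical solution from a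
rapidly decaying datum on [0,T) has a UNIFORM semiconcavity modulus sup_{t<T} K(t) < ∞' implies
NoBlowup (extension past every T). Pure composition of PressureFloorOfSemiconcave and
SereginSverakFloorExtension (term `uniformModulusNoBlowup_of` in the planner's Sketch.lean); records
the bounded-K case of crux C and the card's chain 'semiconcave ⇒ floor ⇒ SS02 ⇒ regular'. X itself
is not filed as an item: X ⇔ NoBlowup (smooth up to T ⇒ K bounded), and X ⇒ P trivially. -/
@[route_item "route-NavierStokesRegularity-HiddenConvexityPressureFloor"]
def UniformModulusNoBlowup : Prop :=
  (∀ (ν T : ℝ), 0 < ν → 0 < T → ∀ (u : ℝ → EuclideanSpace ℝ (Fin 3) → EuclideanSpace ℝ (Fin 3)) (p : ℝ → EuclideanSpace ℝ (Fin 3) → ℝ), Literature.Analysis.FluidPDE.IsClassicalNSSolutionOn (Set.Ico 0 T) ν 0 u p → Literature.Analysis.FluidPDE.IsLerayHopfOn T ν 0 (u 0) u → Literature.Analysis.FluidPDE.HasRapidSpatialDecay (u 0) → ∃ K : ℝ, ∀ t ∈ Set.Ico 0 T, ConcaveOn ℝ Set.univ (fun x : EuclideanSpace ℝ (Fin 3)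 => Literature.Analysis.FluidPDE.normalisedPressure (u t) x - K / 2 * ‖x‖ ^ 2)) → ∀ (ν T : ℝ), 0 < ν → 0 < T → ∀ (u : ℝ → EuclideanSpace ℝ (Fin 3) → EuclideanSpace ℝ (Fin 3)) (p : ℝ → EuclideanSpace ℝ (Fin 3) → ℝ), Literature.Analysis.FluidPDE.IsClassicalNSSolutionOn (Set.Ico 0 T) ν 0 u p → Literature.Analysis.FluidPDE.IsLerayHopfOn T ν 0 (u 0) u → Literature.Analysis.FluidPDE.HasRapidSpatialDecay (u 0) → Literature.Analysis.FluidPDE.HasSmoothExtensionPast ν 0 u T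

-- `UniformModulusNoBlowup` holds: proved by `Summit.NavierStokesRegularity.NavierStokesRegularity.Theorems.hiddenConvexityPressureFloor_uniformModulusNoBlowup_proof` (its module imports this route file, so no `_holds` link can be stated here).

/-- item stmt-NavierStokesRegularity-0055 · assembly · rank 9 · closed · proved by Summit.NavierStokesRegularity.NavierStokesRegularity.Theorems.typeICertificateLadder_noBlowupToClay_proof @ 8d57e70af7e2 (prover) · by planner
Given NoBlowup, build the Clay (A) solution: local finite-energy classical solution for smooth
divergence-free rapidly decaying data (Leray 1934 §III / Fujita–Kato 1964 + LPS smoothing), continue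
past every T using NoBlowup, glue by weak–strong uniqueness (Prodi–Serrin), bounded energy from the
energy inequality, and convert with
Literature.Analysis.FluidPDE.isNavierStokesSolution_and_smooth_iff. Blow-up at spatial infinity is
excluded by CKN ε-regularity applied far out. May take named Literature facts (leray_existence_R3,
ladyzhenskaya_prodi_serrin, weak_strong_uniqueness, fujita_kato_local) as hypotheses if the grounder
so rules. -/
@[route_item "route-NavierStokesRegularity-HiddenConvexityPressureFloor", crux]
def Assembly : Prop :=
  (∀ (ν T : ℝ), 0 < ν → 0 < T → ∀ (u : ℝ → EuclideanSpace ℝ (Fin 3) → EuclideanSpace ℝ (Fin 3)) (p : ℝ → EuclideanSpace ℝ (Fin 3) → ℝ), Literature.Analysis.FluidPDE.IsClassicalNSSolutionOn (Set.Ico 0 T) ν 0 u p → Literature.Analysis.FluidPDE.IsLerayHopfOn T ν 0 (u 0) u → Literature.Analysis.FluidPDE.HasRapidSpatialDecay (u 0) → Literature.Analysis.FluidPDE.HasSmoothExtensionPast ν 0 u T) → NavierStokesRegularity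

/-- `Assembly` holds: proved by `Summit.NavierStokesRegularity.NavierStokesRegularity.Theorems.typeICertificateLadder_noBlowupToClay_proof` @ 8d57e70af7e2. -/
theorem Assembly_holds : Assembly := _root_.Summit.NavierStokesRegularity.NavierStokesRegularity.Theorems.typeICertificateLadder_noBlowupToClay_proof

-- records of items no longer active in this route (dropped / restated):
-- earlier Assembly2 (stmt-NavierStokesRegularity-2966, dropped 2026-08-16T14:43:06Z): moot by None — FinitelyManyTurnovers → OneSidedHessianCriterion → NoBlowupToClay → NavierStokesRegularity

/-! D-0027 §2.1 — DECIDING THEOREM (planner-authored via `route open/edit --closes-file`; by planner-rbadge-NavierStokesRegularity-HiddenCo-829d9e30-g2-0 2026-08-15T17:32:03Z):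
its hypotheses are this route's items and its conclusion the sub-problem Statement (glue_lint), and it elaborates with this file. -/

@[closes "route-NavierStokesRegularity-HiddenConvexityPressureFloor"] theorem closes (hP : FinitelyManyTurnovers) (hC : OneSidedHessianCriterion)
    (hClay : Assembly) : NavierStokesRegularity := by
  apply hClay
  intro ν T hν hT u p hcl hLH hdec
  exact hC ν T hν hT u p hcl hLH hdec (hP ν T hν hT u p hcl hLH hdec)

end Summit.NavierStokesRegularity.NavierStokesRegularity.Theses.HiddenConvexityPressureFloor
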